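import Summits.QuantumFields.BalabanUV.Beta.D1BFx.AssemblyEndRecutS
import Summits.QuantumFields.BalabanUV.Beta.D1BFx.RestTotalOfGroups

/-!
# `BalabanUV.Beta.D1BFx.RestTotalOfGroupsS` — road «BF-x» for binder row D1: the TOTAL off-corner rest bound FROM ONE BOUND PER IDENTITY-CLOSED GROUP OF
# WORDS, TWO-PROFILE RE-CUT TABLE, variant «ENDₛ» (END-ii-SPEC v1.1 §3 (b), chain glue): `RestTotalOfGroups` verbatim with
# `restK' (gp b) ↦ restKS (gp b) (s•gp b)` and `conv_recut ↦ AssemblyEndRecutS.conv_recutS` (the fibrewise regrouping lemma is the record's, by name)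

HONEST DEPENDENCY (page 1, mandatory): continuum YM on T⁴ ⇐ BetaPertH ∧ nine spine estimates (0/9 proved); BetaPertH ⇐ (D1) ∧ (D4) ∧
CAP+tail; G-an2-4 gates asym, D1 and NE2/3/4.  HONEST FRAMING (cell contract, verbatim): «discharging `BetaPertH` makes Bałaban's UV
stability UNCONDITIONAL — a real constructive-QFT result; it is NOT the continuum limit and NOT the Clay problem.»  THIS MODULE DISCHARGES
NOTHING of the wall: [folklore] regrouping + triangle inequality + `Assembly.fullSum_finset_sum` over the (CONV) theorem `AssemblyEndRecutS.conv_recutS` for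
the two-profile words; no `def`, no `Prop` minted, nothing cited, 0 sorry.  0 wall binders; NOT (K), NOT D1, NOT `BetaPertH`, NOT continuum, NOT Clay.

ABSOLUTE RULE (cell charter, verbatim): «No internally-minted statement may enter as a cited fact. Every hypothesis is either kernel-proved in
this package or a verbatim quotation of a PUBLISHED theorem with page reference. The manuscript(s) under audit are NOT citable for their own
disputed steps — they are the thing under adjudication; programme-internal (2001/route/tribunal) claims are never citable.»

CONTENT.
* §1 [folklore] **`restTot_of_groupsS`** (fixed block size, scalar `s`).  §2 **`hRestTot_of_hGroupsS`**, **`hRestTotOdd_of_hGroupsOddS`** (along the block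
  sizes, family `s : ℕ → ℝ`, frozen profile `gfrz`, pinned normalisation).
Unit `b2b-balaban-beta-d1-p2` (road owner, gen 12); `LEAVES-BFx.md` row A7-ENDₛ (glue); END-ii-SPEC v1.1 §3 (b).
-/

noncomputable section

open Finset Filter Topology
open scoped BigOperators
open Literature.MathematicalPhysics.QuantumFieldTheory.Balaban1983to89
open Literature.MathematicalPhysics.QuantumFieldTheory.Balaban1983to89.Beta
open WindowIdentification (fullSum psum)
open B12Sec2to5 (l1)
open DyadicShell (Pt)
open ExpKernelCalculus (Site MKer BiLoc)
open DressedMomentNormalisation (resSite)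
open Summit.QuantumFields.BalabanUV.Beta.TameKernelCalculus (Spr)
open Summit.QuantumFields.BalabanUV.Beta.D1BFx.GluonLeg (Ga)
open Summit.QuantumFields.BalabanUV.Beta.D1BFx.ReducedKernel (TableR)
open Summit.QuantumFields.BalabanUV.Beta.D1BFx.FrozenLegProfile (gfrz decay_gfrz)
open Summit.QuantumFields.BalabanUV.Beta.D1BFx.SplitInstance (RestIdx)
open Summit.QuantumFields.BalabanUV.Beta.D1BFx.SplitInstanceS (restKS)
open Summit.QuantumFields.BalabanUV.Beta.D1BFx.Assembly (fullSum_finset_sum exists_tendsto_psum_finset_sum)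
open Summit.QuantumFields.BalabanUV.Beta.D1BFx.AssemblyEndRecutS (conv_recutS)
open Summit.QuantumFields.BalabanUV.Beta.D1BFx.RoadEndBFxRecut (cornerIdx)
open Summit.QuantumFields.BalabanUV.Beta.D1BFx.RestTotalOfGroups (sum_erase_corner_eq_sum_fiberwise)

namespace Summit.QuantumFields.BalabanUV.Beta.D1BFx.RestTotalOfGroupsS

/-! ## §1 At one block size -/

section Fixed

variable (n : ℕ) [NeZero n] (a : ℝ) {gp : Pt → Pt → ℝ} (cE cΛ cR cK cQ cE₂ cJ4 cΛ₂ cR₂ cQ₂ x₀ ωgl ωgh lam N : ℝ) {WE WJ WΛ WR WQ : TableR}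
  {μ ν : Fin 4} {CE CJ CΛt CRt CQ δW : ℝ} {G : Type*} [Fintype G] [DecidableEq G] {grp : RestIdx → G} {g₀ : G} {CG : G → ℝ}

/-- [folklore] **GROUP BOUNDS IMPLY THE TOTAL OFF-CORNER BOUND, TWO-PROFILE TABLE** (`restKS (gp b) (s•gp b)`, any scalar `s`) at a fixed block size (site-dependent profile `gp b` exponentially bounded; `0 < a`,
`Spr (Ga n a)`, the five slot tables bi-localised at one rate, `μ ≠ ν` — the (CONV) data of `AssemblyEndRecut.conv_recut`): if the words are labelled by
`grp : RestIdx → G` with the corner exactly the fibre of `g₀`, and for every label `g ≠ g₀` the base-point average of the full sum of the SUM of the words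
of fibre `g` is bounded by `CG g`, then the END's off-corner total is bounded by `Σ_{g ≠ g₀} CG g`. -/
theorem restTot_of_groupsS (ha : 0 < a) (hGa : Spr (Ga n a))
    (hg : ∀ b : Pt, ∃ C δ : ℝ, 0 < δ ∧ ∀ v, |gp b v| ≤ C * Real.exp (-δ * l1 v)) (hδW : 0 < δW)
    (hE : ∀ κ u l u', BiLoc (WE κ u l u') u u' CE δW) (hJ : ∀ κ u l u', BiLoc (WJ κ u l u') u u' CJ δW)
    (hΛ : ∀ κ u l u', BiLoc (WΛ κ u l u') u u' CΛt δW) (hR : ∀ κ u l u', BiLoc (WR κ u l u') u u' CRt δW)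
    (hQ : ∀ κ u l u', BiLoc (WQ κ u l u') u u' CQ δW) (hμν : μ ≠ ν) (s : ℝ)
    (hcorner : ∀ τ : RestIdx, grp τ = g₀ ↔ τ = cornerIdx)
    (hGrp : ∀ g : G, g ≠ g₀ → |∑ b ∈ (univ : Finset (Fin 4 → Fin n)).image resSite, ((n : ℝ) ^ 4)⁻¹ *
      fullSum (fun w : Pt => ∑ τ ∈ (univ : Finset RestIdx).filter (fun τ => grp τ = g),
        restKS n a (gp b) (fun v => s * gp b v) cE cΛ cR cK cQ cE₂ cJ4 cΛ₂ cR₂ cQ₂ x₀ WE WJ WΛ WR WQ ωgl ωgh lam N μ ν b τ w)| ≤ CG g) :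
    |∑ b ∈ (univ : Finset (Fin 4 → Fin n)).image resSite, ((n : ℝ) ^ 4)⁻¹ *
      fullSum (fun w : Pt => ∑ τ ∈ (univ : Finset RestIdx).erase cornerIdx,
        restKS n a (gp b) (fun v => s * gp b v) cE cΛ cR cK cQ cE₂ cJ4 cΛ₂ cR₂ cQ₂ x₀ WE WJ WΛ WR WQ ωgl ωgh lam N μ ν b τ w)|
      ≤ ∑ g ∈ (univ : Finset G).erase g₀, CG g := by
  -- regroup the finite word sum by the label, distribute the full sum over the finite set of groups (every group sum converges), swap the two finite sums
  have hfs : ∀ b ∈ (univ : Finset (Fin 4 → Fin n)).image resSite,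
      fullSum (fun w : Pt => ∑ τ ∈ (univ : Finset RestIdx).erase cornerIdx,
        restKS n a (gp b) (fun v => s * gp b v) cE cΛ cR cK cQ cE₂ cJ4 cΛ₂ cR₂ cQ₂ x₀ WE WJ WΛ WR WQ ωgl ωgh lam N μ ν b τ w)
      = ∑ g ∈ (univ : Finset G).erase g₀, fullSum (fun w : Pt => ∑ τ ∈ (univ : Finset RestIdx).filter (fun τ => grp τ = g),
          restKS n a (gp b) (fun v => s * gp b v) cE cΛ cR cK cQ cE₂ cJ4 cΛ₂ cR₂ cQ₂ x₀ WE WJ WΛ WR WQ ωgl ωgh lam N μ ν b τ w) := by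
    intro b _
    obtain ⟨C', δ', hδ', hgb⟩ := hg b
    have e : (fun w : Pt => ∑ τ ∈ (univ : Finset RestIdx).erase cornerIdx,
        restKS n a (gp b) (fun v => s * gp b v) cE cΛ cR cK cQ cE₂ cJ4 cΛ₂ cR₂ cQ₂ x₀ WE WJ WΛ WR WQ ωgl ωgh lam N μ ν b τ w)
        = fun w : Pt => ∑ g ∈ (univ : Finset G).erase g₀, ∑ τ ∈ (univ : Finset RestIdx).filter (fun τ => grp τ = g),
          restKS n a (gp b) (fun v => s * gp b v) cE cΛ cR cK cQ cE₂ cJ4 cΛ₂ cR₂ cQ₂ x₀ WE WJ WΛ WR WQ ωgl ωgh lam N μ ν b τ w :=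
      funext fun w => sum_erase_corner_eq_sum_fiberwise hcorner _
    rw [e]
    exact fullSum_finset_sum _ fun g _ => exists_tendsto_psum_finset_sum _ fun τ _ =>
      conv_recutS n a cE cΛ cR cK cQ cE₂ cJ4 cΛ₂ cR₂ cQ₂ x₀ ωgl ωgh lam N b ha hGa hδ' hgb hδW hE hJ hΛ hR hQ hμν s τ
  rw [sum_congr rfl fun b hb => by rw [hfs b hb, mul_sum], sum_comm]
  refine (abs_sum_le_sum_abs _ _).trans (sum_le_sum fun g hg => ?_)
  exact hGrp g (ne_of_mem_erase hg)

end Fixed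

/-! ## §2 Packaged along the block sizes, at the frozen profile and the pinned normalisation — both parities and odd only -/

section Packaged

variable {a N : ℝ} {μ ν : Fin 4} {cE cΛ cR cK cQ cE₂ cJ4 cΛ₂ cR₂ cQ₂ x₀ ωgl ωgh : ℕ → ℝ} {WE WJ WΛ WR WQ : ℕ → TableR}
  {CE CJ CΛt CRt CQ δW : ℕ → ℝ} {G : Type*} [Fintype G] [DecidableEq G] {grp : RestIdx → G} {g₀ : G} {CG : G → ℝ}

/-- [folklore] **ONE n-UNIFORM BOUND PER GROUP `g ≠ g₀` IMPLIES THE `hRestTot` HYPOTHESIS OF THE «ENDₛ» TOTAL-REST ENDs**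
(`RoadEndBFxTotalShellS.d1Drift_BFx_total_shell_of_prop12S`; two-profile words `restKS (gfrz n a b) (s n • gfrz n a b)`, any family `s : ℕ → ℝ`) with `CRtot := Σ_{g ≠ g₀} CG g` (given the ENDs' common data `0 < a`, `Spr (Ga n a)`, the slot-table
localisation, `μ ≠ ν`, and the corner being exactly the fibre of `g₀`). -/
theorem hRestTot_of_hGroupsS (ha : 0 < a) (hμν : μ ≠ ν) (hGa : ∀ n : ℕ, 2 ≤ n → ∀ [NeZero n], Spr (Ga n a)) (hδW : ∀ n, 0 < δW n)
    (hE : ∀ n κ u l u', BiLoc (WE n κ u l u') u u' (CE n) (δW n)) (hJ : ∀ n κ u l u', BiLoc (WJ n κ u l u') u u' (CJ n) (δW n))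
    (hΛ : ∀ n κ u l u', BiLoc (WΛ n κ u l u') u u' (CΛt n) (δW n)) (hR : ∀ n κ u l u', BiLoc (WR n κ u l u') u u' (CRt n) (δW n))
    (hQ : ∀ n κ u l u', BiLoc (WQ n κ u l u') u u' (CQ n) (δW n)) (s : ℕ → ℝ)
    (hcorner : ∀ τ : RestIdx, grp τ = g₀ ↔ τ = cornerIdx)
    (hGrp : ∀ n : ℕ, 2 ≤ n → ∀ [NeZero n], ∀ g : G, g ≠ g₀ →
      |∑ b ∈ (univ : Finset (Fin 4 → Fin n)).image resSite, ((n : ℝ) ^ 4)⁻¹ *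
        fullSum (fun w : Pt => ∑ τ ∈ (univ : Finset RestIdx).filter (fun τ => grp τ = g),
          restKS n a (gfrz n a b) (fun v => s n * gfrz n a b v) (cE n) (cΛ n) (cR n) (cK n) (cQ n) (cE₂ n) (cJ4 n) (cΛ₂ n) (cR₂ n) (cQ₂ n) (x₀ n)
            (WE n) (WJ n) (WΛ n) (WR n) (WQ n) (ωgl n) (ωgh n) ((n : ℝ) ^ 8) N μ ν b τ w)| ≤ CG g) :
    ∀ n : ℕ, 2 ≤ n → ∀ [NeZero n],
      |∑ b ∈ (univ : Finset (Fin 4 → Fin n)).image resSite, ((n : ℝ) ^ 4)⁻¹ *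
        fullSum (fun w : Pt => ∑ τ ∈ (univ : Finset RestIdx).erase cornerIdx,
          restKS n a (gfrz n a b) (fun v => s n * gfrz n a b v) (cE n) (cΛ n) (cR n) (cK n) (cQ n) (cE₂ n) (cJ4 n) (cΛ₂ n) (cR₂ n) (cQ₂ n) (x₀ n)
            (WE n) (WJ n) (WΛ n) (WR n) (WQ n) (ωgl n) (ωgh n) ((n : ℝ) ^ 8) N μ ν b τ w)|
        ≤ ∑ g ∈ (univ : Finset G).erase g₀, CG g := by
  intro n hn _
  exact restTot_of_groupsS n a (cE n) (cΛ n) (cR n) (cK n) (cQ n) (cE₂ n) (cJ4 n) (cΛ₂ n) (cR₂ n) (cQ₂ n) (x₀ n) (ωgl n) (ωgh n)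
    ((n : ℝ) ^ 8) N ha (hGa n hn) (fun b => decay_gfrz (hGa n hn) b) (hδW n) (hE n) (hJ n) (hΛ n) (hR n) (hQ n) hμν (s n) hcorner (hGrp n hn)

/-- [folklore] **THE SAME AT ODD BLOCK SIZES ONLY (two-profile table)** — the SPEC's shape `∀ n ≥ 2, Odd n → ∀ g ≠ g₀, …`: group bounds at odd `n` imply the off-corner rest
total bound `≤ Σ_{g ≠ g₀} CG g` at odd `n` (for an END that consumes the rest total only inside its `Odd n` defect callback). -/
theorem hRestTotOdd_of_hGroupsOddS (ha : 0 < a) (hμν : μ ≠ ν) (hGa : ∀ n : ℕ, 2 ≤ n → ∀ [NeZero n], Spr (Ga n a)) (hδW : ∀ n, 0 < δW n)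
    (hE : ∀ n κ u l u', BiLoc (WE n κ u l u') u u' (CE n) (δW n)) (hJ : ∀ n κ u l u', BiLoc (WJ n κ u l u') u u' (CJ n) (δW n))
    (hΛ : ∀ n κ u l u', BiLoc (WΛ n κ u l u') u u' (CΛt n) (δW n)) (hR : ∀ n κ u l u', BiLoc (WR n κ u l u') u u' (CRt n) (δW n))
    (hQ : ∀ n κ u l u', BiLoc (WQ n κ u l u') u u' (CQ n) (δW n)) (s : ℕ → ℝ)
    (hcorner : ∀ τ : RestIdx, grp τ = g₀ ↔ τ = cornerIdx)
    (hGrp : ∀ n : ℕ, 2 ≤ n → Odd n → ∀ [NeZero n], ∀ g : G, g ≠ g₀ →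
      |∑ b ∈ (univ : Finset (Fin 4 → Fin n)).image resSite, ((n : ℝ) ^ 4)⁻¹ *
        fullSum (fun w : Pt => ∑ τ ∈ (univ : Finset RestIdx).filter (fun τ => grp τ = g),
          restKS n a (gfrz n a b) (fun v => s n * gfrz n a b v) (cE n) (cΛ n) (cR n) (cK n) (cQ n) (cE₂ n) (cJ4 n) (cΛ₂ n) (cR₂ n) (cQ₂ n) (x₀ n)
            (WE n) (WJ n) (WΛ n) (WR n) (WQ n) (ωgl n) (ωgh n) ((n : ℝ) ^ 8) N μ ν b τ w)| ≤ CG g) :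
    ∀ n : ℕ, 2 ≤ n → Odd n → ∀ [NeZero n],
      |∑ b ∈ (univ : Finset (Fin 4 → Fin n)).image resSite, ((n : ℝ) ^ 4)⁻¹ *
        fullSum (fun w : Pt => ∑ τ ∈ (univ : Finset RestIdx).erase cornerIdx,
          restKS n a (gfrz n a b) (fun v => s n * gfrz n a b v) (cE n) (cΛ n) (cR n) (cK n) (cQ n) (cE₂ n) (cJ4 n) (cΛ₂ n) (cR₂ n) (cQ₂ n) (x₀ n)
            (WE n) (WJ n) (WΛ n) (WR n) (WQ n) (ωgl n) (ωgh n) ((n : ℝ) ^ 8) N μ ν b τ w)|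
        ≤ ∑ g ∈ (univ : Finset G).erase g₀, CG g := by
  intro n hn hon _
  exact restTot_of_groupsS n a (cE n) (cΛ n) (cR n) (cK n) (cQ n) (cE₂ n) (cJ4 n) (cΛ₂ n) (cR₂ n) (cQ₂ n) (x₀ n) (ωgl n) (ωgh n)
    ((n : ℝ) ^ 8) N ha (hGa n hn) (fun b => decay_gfrz (hGa n hn) b) (hδW n) (hE n) (hJ n) (hΛ n) (hR n) (hQ n) hμν (s n) hcorner (hGrp n hn hon)

end Packaged

end Summit.QuantumFields.BalabanUV.Beta.D1BFx.RestTotalOfGroupsS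

end
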